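import Summits.BirchSwinnertonDyer.BirchSwinnertonDyer.Theses.PrintX11a
import Summits.BirchSwinnertonDyer.BirchSwinnertonDyer.Theorems.PrintX11aUpperNonSurjFiveDepthStrata
import HarnessLib

/-!
# Line «twpatch5» for crux U5 = `PrintX11a.UpperNonSurjFive` (item `stmt-BirchSwinnertonDyer-20614`)

bsd-idea-6 g15, lens «decomp», CRUX-LEVEL ONLY (D-0152 ∕ W-71; W-79 publish-only: this file is PUBLISHED with `ledger crux write`,
never `skeleton check`ed — the line of record is «gl1cartan5» rev 12; its open cores are C_Ш and C_cc = C_T1 ⊔ C_T2).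

## Idea (one paragraph)

TAYLOR–WILES PATCHING IS AVAILABLE ON U5, AND IT MAKES TAMAGAWA DEPTH ADDITIVE OVER THE CARRIERS.
Every road in the tree treats the small image of `ρ̄ = E[p]` on X11a (`5S4` at `p = 5`, Cartan normalisers `pNs`/`pCs`) as the
reason Euler-system and Heegner machinery caps out (barriers `EulerSystemBigImageAtSmallImage`, `StringentKolyvaginCapsAtMax`), and
line «oldprod5» left «integral `R = 𝕋` at `p ∥ N`» as research.  But the hypothesis of Wiles ∕ Taylor–Wiles ∕ Diamond ∕ Kisin patching
is NOT big image: it is «`ρ̄|G_{ℚ(ζ_p)}` absolutely irreducible» (`TaylorWiles` below) — invariantly: `G ∩ SL₂(𝔽_p)` NON-ABELIAN for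
`G = im ρ̄` (`ℚ(ζ_p)` is the fixed field of `det ρ̄`) — and it HOLDS AT EVERY PAIR OF U5 (rev 2, Lemma S4 `TWOnU5`, elementary: multiplicative
reduction at `p` puts a half split Cartan `{diag(a,1)}` in `G` (Serre 1972 Prop. 13), and an irreducible `G ⊉ SL₂` with abelian `G ∩ SL₂`
would sit in a Cartan normaliser `N(C)` with `C` split ⊇ that half-Cartan (Serre Prop. 14, `p ≥ 5`), forcing `G = N(C_s)` whose `SL₂`-part
`Q_{2(p−1)}`-type group is non-abelian — contradiction; table at `p = 5`: `5S4 ↦ 2·A₄ ⊇ Q₈`, full `5Ns ↦ Q₈`, both non-abelian, and these are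
the only images on U5); `p ∥ N` is Wiles's type (Se)/(str) at `p` (ordinary, `D_p`-distinguished
since `ω|D_p ≠ 1` for `p ≥ 5`), where `R_Σ = 𝕋_Σ` and multiplicity one (Wiles Thm. 2.1) are in print.  So on U5 the full Hecke ring
`R := 𝕋_𝔪` (level `N = N_E`, non-Eisenstein `𝔪 = (p, 𝕀_f)`) is a quotient `R_∞/(y₁,…,y_r)` of a patched power-series ring over the
completed tensor product of LOCAL lifting rings, and both `R` and the `S`-new quotient `R̄ := R/(b_ℓ : ℓ ∈ S)` (Steinberg at every
split multiplicative prime `ℓ ∈ S`) are complete intersections (Böckle–Khare–Manning §1: patching ⟹ `𝕋^Q` c.i. whenever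
`ρ̄(Frob_q) ≠ ±1`).  At a GENERIC carrier `ℓ ≠ p` (`ρ̄` unramified at `ℓ`, Frobenius eigenvalues `{1, ℓ}`, `p ∤ ℓ² − 1`) the local
ring is the normal crossing `𝒪⟦a_ℓ, b_ℓ, …⟧/(a_ℓ b_ℓ)`: `{a_ℓ = 0}` = unramified lifts (= `ℓ`-old forms), `{b_ℓ = 0}` = Steinberg lifts
(∋ `f = f_E`), and `ord_p θ_f(a_ℓ) = ord_p c_ℓ =: n_ℓ` EXACTLY (`ρ_f mod p^m` unramified at `ℓ` ⟺ `p^m ∣ c_ℓ = v_ℓ(Δ)`, Tate curve);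
at `ℓ = p` split, Wiles's type-(Se) ordinary ring has the same shape (flat ∪ Steinberg, `ord_p θ_f = v_p(Δ) = n_p`).  THREE consequences,
none of which a single-eigenform congruence can see (CORES-DIAGNOSIS-g7 §3(a): eigenform chains give `max n_ℓ`, BSD wants `Σ n_ℓ`):
(i) `R = 𝕋` ⟹ ideal-theoretic level lowering modulo `p^{n_ℓ}` for free (`θ_f mod p^{n_ℓ}` factors through `𝕋^{ℓ-old} = R/(a_ℓ)`);
(ii) [rev 1–2; WITHDRAWN in rev 3 — see «REV 3» below: annihilators and intersections do not descend along `R_∞ ↠ R`; replaced by (ii′)] TRANSVERSALITY: `Ann_{R_∞}(b_S) = (∏_ℓ a_ℓ)` (monomial: `(a₁,J) ∩ (a₂,J) = (a₁a₂) + J`, `J = (a₁b₁, a₂b₂)`, the Stanley–Reisner ring of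
the path `a₁–b₂–b₁–a₂` is Cohen–Macaulay, `y` is regular) and the c.i. change-of-congruence-module formula give
`η_f(R)/η_f(R̄) = θ_f(∏ a_ℓ)·unit = p^{Σ n_ℓ}`, whence — `R`, `R̄` Gorenstein, annihilators of `℘_f` principal — the `f`-ISOLATOR
`t_f` (generator of `Ann_R ℘_f`) satisfies `t_f ∈ (b_S) + p^{Σ n_ℓ}·R` (checked by hand in the 4-point tensor model);
(iii) VALUE: work in the `W_S`-anti-invariant lattice `M^{−S} ⊂ H₁(X₀(N), ℤ_p)⁻_𝔪` (`W_ℓ f = −f` as `a_ℓ(f) = +1`), free of rank one over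
`R` (multiplicity one), so the primitive `f`-cycle is `φ_f = t_f·m₀ ∈ (b_S)·M^{−S} + p^{Σn}M ⊂ Σ_ℓ (α_ℓ^♮ − β_ℓ^♮)H₁(X₀(N/ℓ)) + p^{Σn}M`
(single-prime Ihara saturates each `ℓ`-old part); and the winding cycle `e = {0, i∞}` has `α_{ℓ*}e = β_{ℓ*}e` for EVERY `ℓ ∣ N`
(`z ↦ ℓz` fixes the geodesic), i.e. `e ⊥ (α^♮ − β^♮)H₁(X₀(N/ℓ))` under the intersection pairing; hence
`L(f,1)/Ω_f^{can} = ⟨e, φ_f⟩ ≡ 0 (mod p^{Σ_ℓ n_ℓ})`, and `Ω^{can} = Ω_E·(p-unit)` (Agashe–Ribet–Stein at `p ∥ N`, Mazur's Manin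
Cor. 4.1, Greenberg–Vatsal Rem. 3.4) turns this into `ord_p (L(E,1)/Ω_E) ≥ ord_p ∏_ℓ c_ℓ` — the displayed binder `hV` of the record's
socket `GL1Cartan.tamagawaDepthCore_of_valueDepth` (p695354), with NO `Ш` and NO depth hypothesis (BSD-true: `p ∤ #E(ℚ)_tors`).
RESIDUAL with a named tool: vexing ∕ trivial carriers `p ∣ ℓ² − 1` (`R_ℓ^St` not Gorenstein at trivial `ℓ`: the Böckle–Khare–Manning
WILES DEFECT, Manning, Shotton's components).  The would-be dihedral residual `¬ TaylorWiles` is EMPTY on U5 (Lemma S4; rev 1 carried it as a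
research stub with Thorne 2016 ∕ Skinner–Wiles as tools — no longer needed).  The `Ш`-core is the record's C_Ш.

REV 2 (2026-08-29, pays idea-crit-10 V#152 P1–P3): P1 the TW criterion is stated invariantly (`G ∩ SL₂` non-abelian) and the `¬TW` locus is
decided — EMPTY on U5 by Serre 1972 Props. 13–14 (S4 is now the elementary lemma `TWOnU5`, size M; «5Cs» dropped: a split-Cartan image is
reducible, excluded by `Irr`); P2 `monomialTransversality` is PROVED (kernel) below; P3 the falsifier box of S2 ∕ S3 carries the in-tree record
values (all 44 tabulated U5 pairs at `p = 5`: `v₅(L(E,1)/Ω_E) = v₅(∏c)` — 14 × 0, 28 × 1, 2 × 2 — equality everywhere, S2's inequality holds at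
its 42 rows, S3's at its 1 row `118080ds1`, `52345c1` (split `29 ≡ −1`, depth 1) lies outside C_cc).

REV 3 (2026-08-30, bsd-idea-6 g36; CONTENT rev of the mechanism of S2 only — statements, stubs and composition are byte-identical to rev 2).
REV 3 add. (2026-08-30 05:12Z, g36; idea-crit-10 V#173 PRICE P1 + nits n1 ∕ n2 folded — DOCSTRING TEXT ONLY, code byte-identical to REV 3 commit 6d9e1ef8855b):
the KIT-T family record (REF g31 §ZH add. 1 + §ZJ + §ZJ add. 1: 16 ∕ 16 `ob(η) = 0`, all at `δ₁₂ = 1`) is CONSISTENT with (ii′) and does NOT discriminate it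
from the typed S3; the falsifiers below are ranked by discriminating power; the §5 no-go is cited as a sketch under P1–P3 with a numerically verified
identity, not as a theorem; n1 (local conditions at the NON-carrier primes of `N`) is memo §1 ∕ §4 (e) rev; n2: monogen5's typed S2 ∕ S3 ∕ S5 stay as they
are until a referee signs P⁺4–P⁺5.
REV 4 (2026-08-30, bsd-idea-6 g37; DOCSTRING TEXT ONLY — statements, the five stubs, every proof and the composition are byte-identical to REV 3 ∕ REV 3 add.,
commit e1a568b22838).  WHAT HAPPENED (REF g31 §ZK 05:25:33Z, evidence #58 on 20614): falsifier (1) below, KIT-T‴, was RUN at the clean three-carrier level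
`9890 = 43·2·23·5` @ `p = 5` (carriers `2, 23` ♭ at depths 1, 2 and `5 = p` with `a₅(43a) ≡ 1`; kit j338489, kitT5.gp, 29 min; `r = 9`, mult. one ✓, Gorenstein ✓,
`ν(Iᵢ) = 1` ×3, all eight old∕new member types inhabited): **`ob₃(η) = 0` (`η ∈ 𝔞₁𝔞₂𝔞₃`) and at the single triply-new member `v₅(λ_{g_nnn}(t_η)) = 3 = 1+1+1`**,
strictly above the (W)+S3 bound `max + 1 = 2` — the first row of the KIT-T family that DISCRIMINATES (ii′)'s «sum» from monogen5's typed «max + 1», and it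
sides with (ii′) (family: 17 levels, 0 kills; the «16 ∕ 16» counts below are REV 3's).  Falsifier (3), member-wise, was run too (kitT4v, kit j338481 ∕ j338482):
17 single-member values (REF §ZK + §ZL): 15 EQUAL to `Σ_{new} nᵢ(g) + Σ_{old} v(αᵢ(g) − 1)`, 2 ABOVE it by one (the doubly-new `N`-members of 14467@5 and
13685@5: `3 = (n₁+n₂) + 1` — in BSD's reading `5 ∣ #Ш` or a depth-2 ∕ non-carrier Tamagawa factor of that newform; kitT4w j338761 separates what `𝕋` forces),
NONE below; and `ob(η) = 0` + the multi-member orbit totals PREDICT ramification indices of member primes, confirmed BSD-free by REF's verify3 (j338680) at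
the two sharp cases so far (86-orbit `e = 2, f = 1` ✓, 1079-orbit, degree-32 Hecke field, `e = 3, f = 1` ✓; 7973 ∕ 6279 pending).  REF's caveats endorsed: computational, one three-carrier level, `δ₁₂ = 2`
there is third-carrier-induced (not the `δ ≥ 2` regime of falsifier (2)).  REF §ZL CONCURS PASS on REV 3 (+ add. 2) (price P1 paid), no clock.  REF AUDIT POINTS folded into S2's
docstring: (f) P⁺5 uses the ♭ separation `αᵢ − βᵢ ≡ 1 − ℓᵢ` invertible — which IS this stub's genericity binder `¬ p ∣ ℓ² − 1` (it implies `ℓ ≢ 1`); (g) P⁺7 uses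
`M = 𝕋γ` AND «no `p`-isogeny» (`Irr`, a `ClassX11a` conjunct) for the period comparison.  SHADOW (s2) of P⁺5 (`ker(M → M^{old,i}) = IᵢM`): ANSWERED by REF with
0 new kit — automatic from `M ≅ 𝕋` + the rank count `ℓ(Y/(IᵢY + p^K)) = K·oᵢ` (34 ∕ 34 (level, carrier) instances); CLOSED numerically, OPEN only as print item (b′).
NOT refereed by REF (explicitly): print-compositeness of P⁺1–P⁺7 — a LEAD ∕ critic audit.  CROSS-LINE (monogen5 REV 8, same crux directory): monogen5 now carries
the DEFINITION S∑ `MonoGen.CleanCarrierSum` (= this stub's conclusion restricted to monogen5's CLEAN levels) with a kernel-checked composition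
`MonoGen.UpperNonSurjFive_of_cleanCut : S1 → S∑ → S4♮ → S4ₚ → S5♮ → S6 → U5` and the PROVED bridge `MonoGen.cleanCarrierSum_of_generic` over an abstract
TW predicate, which this file's `stub_taylorWiles_of_classX11a` + `stub_valueDepthTW` instantiate by inspection (clean ⟹ generic via
`MonoGen.not_dvd_sq_sub_one_of_flatPrime`; `Lines/*.lean` are not importable modules, so the instantiation is not a compiled term): THE TWO LINES SHARE THE CLEAN
SECTOR, this S2 being the stronger (generic ⊋ clean) statement.  BSD is not proved by any of this; U5 does not close.
WHAT WAS WRONG WITH (ii).  monogen5 §5 (REV 5–6, NO-GO Proposition, patching axioms P1–P3; a SKETCH under those axioms whose identity REF g31's KIT-T family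
verifies numerically 16 ∕ 16 at clean two-carrier levels, all with `δ₁₂ = 1`) shows that in the HECKE RING `R = 𝕋_𝔪 = R_∞/𝔰` the two level-raising bi-kernel ideals `𝔞ᵢ = (U_{ℓᵢ} − 1) + I_{ℓᵢ}`
satisfy `ℓ((𝔞₁ ∩ 𝔞₂)/𝔞₁𝔞₂) = δ₁₂ ≥ 1`: intersection ≠ product DOWNSTAIRS.  Rev 2's (ii) computed annihilators and intersections UPSTAIRS in
`R_∞` (correctly: `monomialTransversality`) and then used them downstairs — but `Ann` and `∩` are not functorial along `R_∞ ↠ R`; that is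
the gap, and it is exactly what the no-go records.  WHAT REPLACES IT — (ii′) THE PATCHED WINDING ELEMENT (memo
`Cruxes/UpperNonSurjFive/MECHANISM-patched-winding-element-g36.md`, steps P⁺1–P⁺7; SKETCH, not refereed): ELEMENTS descend.  The winding
element exists at every Taylor–Wiles level (`η_n = e_𝔪{0,i∞} ∈ M_n = H₁(X_{Q_n}(N))⁺_𝔪`, rescaled by the automatic units
`∏_q (α_q − 1)/(α_q − β_q)`), and so does the Euler-factor vanishing (W): `η_n ∈ (U_{ℓᵢ} − 1)M_n + ker(M_n ↠ M_n^{ℓᵢ-old})` for each carrier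
(modular symbols: `(π₁₊,π₂₊)η = (η′,η′) = (U − 1)(0, −η′)` with `U(a,b) = (T_ℓ a − b, ℓa)`, plus the dual Ihara lemma — Ribet 1984 at any
level prime to `ℓ`, Diamond–Ribet at `ℓ = p`).  PATCH the pointed data `(M_n, η_n, M_n ↠ M_n^{old,i})`: upstairs `M_∞ ≅ R_∞` (multiplicity one at
level `N` + `R_∞` reduced + every component inhabited, Diamond–Taylor), the patched old-kernel is the LOCAL ideal `𝔫ᵢM_∞`,
`𝔫ᵢ = ker(R^□_{ℓᵢ} → R^{□,ur}_{ℓᵢ})` (free rank one ↠ full support over a reduced ring ⇒ iso), so `η_∞ ∈ 𝔄₁M_∞ ∩ 𝔄₂M_∞` with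
`𝔄ᵢ = (αᵢ − 1) + 𝔫ᵢ ⊂ R^□_{ℓᵢ}` (`αᵢ` = the Hensel root `≡ 1` of Frobenius, defined because `ℓᵢ` is ♭; `↦ U_{ℓᵢ}`); the two ideals come from
DIFFERENT tensor factors of `R_∞ = (R^□_{ℓ₁} ⊗̂ R^□_{ℓ₂} ⊗̂ R′)⟦x⟧` and `R^□_{ℓ}/𝔄 = R^{□,ur}/(α − 1)` is `𝒪`-flat, so
`Tor₁^{R_∞}(R_∞/𝔄₁, R_∞/𝔄₂) = 0` and `𝔄₁M_∞ ∩ 𝔄₂M_∞ = 𝔄₁𝔄₂M_∞` (kernel toy `biKernelTransversality` below); membership DESCENDS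
(`membership_descends` below): `η ∈ 𝔞₁𝔞₂·M`, i.e. monogen5's S3⁺ ∕ `ob(η) = 0` — PREDICTED at every clean level (the KIT-T family's 16 ∕ 16 at `δ₁₂ = 1` is
CONSISTENT with it but, given (W), equivalent there to the typed S3 «max + 1» — REF §ZJ add. 1 (d): it does not discriminate) — and with `k`
factors `η ∈ (∏ᵢ 𝔞ᵢ)M`.  VALUE (iii′), replacing (iii): evaluate at `x_E`: `𝔄ᵢ(x_E) = (a_{ℓᵢ}(E) − 1, 𝔫ᵢ(x_E)) = (ord_{ℓᵢ} q_E)ℤ_p = p^{nᵢ}ℤ_p`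
(Tate curve ∕ Kummer; at `ℓᵢ = p`: `E[p^m]` is finite flat for `p^m ∣ v_p(q_E)`, so `x_E mod p^m` lies on the flat = crystalline-ordinary
component), and `t_η(f_E) = (L(E,1)/Ω_E)·unit` (period lattice ⊗ ℤ_p generated through `M`; Manin ∕ ARS ∕ `c_∞` units) ⇒ `ord_p(L(E,1)/Ω_E) ≥
Σᵢ nᵢ = v_p ∏_ℓ c_ℓ` on the generic (= clean) locus — the statement `ValueDepthTW` (UNCHANGED), now with a mechanism that respects the no-go.
No Ribet–Takahashi ∕ node-principality and no `R = 𝕋` at `N/ℓ` is used in (iii′).  NEAREST PRINT (unchanged verdict «transplant»): additivity of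
the depths `t_f(q) = n_q` for CONGRUENCE IDEALS ∕ modular degrees — Ribet–Takahashi 1997, Pollack–Weston 2011, Kim–Ota Thm 1.3 (TW hypothesis +
the clean-type condition (5), «inevitable»), Böckle–Khare–Manning II 2024 (one RT inequality by patching alone), Manning–Shotton 2021 (Ihara via
patching: the module-theoretic shape of P⁺5) — none of them for the winding element ∕ `L(E,1)/Ω_E` (search log in the memo and the card).
HONEST LABEL: (ii′) is a print-composite SKETCH with four steps not verbatim in print (patching marked elements; the kernel comparison; the
`ℓ = p` factor; `p = 5` constants) — S2 stays a `sorry`d stub of size L–XL; what changed is that its mechanism no longer contradicts the §5 no-go (a sketch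
under P1–P3 whose identity is verified numerically 16 ∕ 16).  FALSIFIERS, RANKED BY DISCRIMINATING POWER (REV 3 add., V#173 P1 fold; REF asks, kit 0 here): (1) KIT-T‴ — `η ∈ 𝔞₁𝔞₂𝔞₃` at a
clean THREE-carrier level at depths (1,1,1), where (ii′) says `v_p(λ_N(η)) ≥ 3` at the triply-new member and (W)+S3 only `max + 1 = 2` (critic's
model: `⋂𝔞ᵢ = p·δ₁₁₁`, `∏𝔞ᵢ = p³·δ₁₁₁`, obstruction group `ℤ/p²`) — accessible to REF's dense engine, THE cheapest discriminating row, one failure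
kills (ii′) and the whole «sum» family; (2) KIT-T′ — `ob(η) = 0` at `δ₁₂ ≥ 2` (`ψ(N) ≥ 173184`, infeasible for the dense engine); (3) member-wise
`v(t_η(g)) ≥ Σ_{new} nᵢ(g) + Σ_{old} v(αᵢ(g) − 1)` (at old members an Euler-factor identity, at new members a BSD-shaped divisibility — least
discriminating).  STANDING CAVEAT: every numerical row of this family checks a BSD_p-predicted divisibility for newform members — it CALIBRATES,
and refutes only if that divisibility fails; the (ii′)-specific, BSD-independent shadows are STRUCTURAL: multiplicity one at `N` (16 ∕ 16 ✓), the
finite-level shadow of P⁺5 «`ker(M → M^{old,i}) = IᵢM` ⟺ `M^{old,i}` is free of rank one over `𝕋^{old,i}`» (asked of REF on the existing KIT-T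
lattices, 0 new kit), and the rescaling units `u_n`.

## Registered stubs (5) and composition

S1 `PrintFacts` (13 Literature facts, = «oldprod5» S1 verbatim) · S2 `ValueDepthTW` (THE ENGINE: generic carriers, TW hypothesis) ·
S3 `ValueDepthVexing` (residual: a carrier with `p ∣ ℓ² − 1`) · S4 `TWOnU5` (elementary LEMMA: the TW hypothesis holds on all of U5) · S5 `ShaCore`
(= record C_Ш).  `UpperNonSurjFive_of_twpatch : Theses.PrintX11a.UpperNonSurjFive` — real proof: S4 gives TW, case split generic ∕ vexing ⟹ `hV` on
the whole C_cc locus ⟹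
`tamagawaDepthCore_of_valueDepth` ⟹ `upperNonSurjFive_of_elevenFacts_of_twoCores` (p691730).  CONDITIONAL on every stub; BSD is not
proved by any of this; the record skeleton is untouched.

[cite: Wiles1995, Thm. 2.1, Thm. 3.3 (types (Se), (str); hypothesis: ρ̄ restricted to ℚ(√p*) absolutely irreducible)] [cite: TaylorWiles1995, Thm. 1]
[cite: Diamond1996, Thm. 1.1] [cite: Diamond1997, Thm. 2.4] [cite: Kisin2009, (3.4.12)] [cite: BockleKhareManning2021, §1 (arXiv:1910.08507 p. 3), §3 items 1–5 (p. 13)]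
[cite: Shotton2016, Thm. 1.1] [cite: Serre1972PointsOrdreFini, §1.12 Prop. 13, §2.2 Prop. 14, §2.4 Prop. 15] [cite: AgasheRibetStein2012, Thm. 2.7]
[cite: Mazur1978, Cor. 4.1] [cite: GreenbergVatsal2000, Rem. 3.4] [cite: KimOta2019CongruenceIdeals, Thm. 1.3 (arXiv:1905.02926 p. 3)] [cite: Miller2011LMS, Def. 1.1]
[cite: RibetTakahashi1997, Thm. 1] [cite: PollackWeston2011, Thm. 1.2 (as quoted in arXiv:1905.02926 p. 3)] [cite: BoeckleKhareManning2024, §1, Lemma 6.3, Thm. 6.4 (arXiv:2108.09729)]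
[cite: ManningShotton2021 — no bib key: J. Manning, J. Shotton, «Ihara's lemma for Shimura curves over totally real fields via patching», Math. Ann. 379 (2021)] [cite: Ribet1984ICM, Ihara's lemma] [cite: DiamondTaylor1994, Thm. A] [cite: Kisin2008 — no bib key: M. Kisin, «Potentially semi-stable deformation rings», J. Amer. Math. Soc. 21 (2008), §2.7, Thm. 3.3.4] [cite: Snowden2018Singularities, §4 (arXiv:1111.3654)]
-/

set_option linter.dupNamespace false
set_option autoImplicit false

noncomputable section

open scoped Classical NumberField

open WeierstrassCurve Field
  Literature.NumberTheory.EllipticCurves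
  Literature.NumberTheory.EllipticCurves.ModularForms
  Literature.NumberTheory.EllipticCurves.Rank1Residual
  Literature.NumberTheory.EllipticCurves.Rank1Residual.Typed
  Summit.BirchSwinnertonDyer.Rank1Residual
  Summit.BirchSwinnertonDyer.BirchSwinnertonDyer.Theorems.GL1Cartan

namespace Summit.BirchSwinnertonDyer.BirchSwinnertonDyer.Cruxes.UpperNonSurjFive.TWPatch

/-! ## §1 The new object: the Taylor–Wiles hypothesis (NOT big image) and the toy of transversality -/

/-- `σ ∈ Γ_ℚ` fixes every `p`-th root of unity of `ℚ̄`, i.e. `σ ∈ G_{ℚ(μ_p)}` (same idiom as the tree's `BigIm`). [folklore] -/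
def FixesMuP (p : ℕ) (σ : absoluteGaloisGroup ℚ) : Prop :=
  ∀ ζ : AlgebraicClosure ℚ, ζ ^ p = 1 → absoluteGaloisGroup.toAlgEquiv ℚ σ ζ = ζ

/-- **The Taylor–Wiles hypothesis** for `ρ̄ = E[p]`: the restriction of `ρ̄` to `G_{ℚ(μ_p)}` is ABSOLUTELY irreducible — typed as
«`E[p]` has no proper non-zero `G_{ℚ(μ_p)}`-stable subgroup, and `G_{ℚ(μ_p)}` acts on `E[p]` through a non-commutative group»
(for a subgroup `H ≤ GL₂(𝔽_p)`: absolutely irreducible ⟺ irreducible and non-abelian, since an irreducible abelian `H` sits in a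
non-split Cartan).  Equivalent (Clifford) to Wiles's «`ρ̄|ℚ(√(−1)^{(p−1)/2} p)` absolutely irreducible», and — since `ℚ(ζ_p)` is the
fixed field of `det ρ̄` — to «`G ∩ SL₂(𝔽_p)` non-abelian» for `G = im ρ̄` (table at `p = 5`: `5S4 ↦ 2·A₄ ⊇ Q₈` ✓, full `5Ns = N(C_s) ↦ Q₈` ✓,
full `5Nn ↦ Dic₃` ✓; an index-2 subgroup of `N(C_s)(𝔽₅)` with surjective `det` has `|G ∩ SL₂| = 4`, abelian ✗ — but such images do
not occur on U5: Lemma S4 `TWOnU5`).  It is NOT a big-image hypothesis.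
[cite: Wiles1995, Introduction (hypothesis on ρ̄ restricted to ℚ(√p*))] [cite: TaylorWiles1995, Thm. 1] [cite: Serre1972PointsOrdreFini, §2.2] -/
def TaylorWiles (W : WeierstrassCurve ℚ) (p : ℕ) : Prop :=
  (∀ H : AddSubgroup (W.geomTorsion p),
      (∀ σ : absoluteGaloisGroup ℚ, FixesMuP p σ → ∀ P ∈ H, σ • P ∈ H) → H = ⊥ ∨ H = ⊤) ∧
    ∃ σ τ : absoluteGaloisGroup ℚ, FixesMuP p σ ∧ FixesMuP p τ ∧
      ∃ P : W.geomTorsion p, σ • (τ • P) ≠ τ • (σ • P)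

/-- **FIRST LEMMA of the line (toy of transversality, typed; not a stub).**  In `ℤ[a₁,b₁,a₂,b₂]` with `J = (a₁b₁, a₂b₂)` (two
normal-crossing local factors `𝒪⟦a,b⟧/(ab)`): `(a₁) + J` and `(a₂) + J` meet in `(a₁a₂) + J` — the unramified-at-`ℓ₁` and
unramified-at-`ℓ₂` ideals of the patched ring intersect in their PRODUCT, which is what makes lowering depths ADD.  (Monomial ideals:
pairwise lcm's.) [folklore] -/
def MonomialTransversality : Prop :=
  let a₁ : MvPolynomial (Fin 4) ℤ := MvPolynomial.X 0
  let b₁ : MvPolynomial (Fin 4) ℤ := MvPolynomial.X 1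
  let a₂ : MvPolynomial (Fin 4) ℤ := MvPolynomial.X 2
  let b₂ : MvPolynomial (Fin 4) ℤ := MvPolynomial.X 3
  Ideal.span {a₁, a₁ * b₁, a₂ * b₂} ⊓ Ideal.span {a₂, a₁ * b₁, a₂ * b₂} =
    Ideal.span {a₁ * a₂, a₁ * b₁, a₂ * b₂}

/-- **The first lemma HOLDS (kernel; rev 2 pays V#152 P2).**  Monomial ideals: membership is support-wise domination
(`MvPolynomial.mem_ideal_span_monomial_image`), and `e₀ ≤ m ∧ e₂ ≤ m ⟹ e₀ + e₂ ≤ m` for the distinct coordinate vectors `e₀, e₂`. [folklore] -/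
theorem monomialTransversality : MonomialTransversality := by
  -- exponent vectors
  let e : Fin 4 → (Fin 4 →₀ ℕ) := fun i => Finsupp.single i 1
  have hX : ∀ i : Fin 4, (MvPolynomial.X i : MvPolynomial (Fin 4) ℤ) = MvPolynomial.monomial (e i) 1 := fun i => rfl
  have hXX : ∀ i j : Fin 4, (MvPolynomial.X i * MvPolynomial.X j : MvPolynomial (Fin 4) ℤ) =
      MvPolynomial.monomial (e i + e j) 1 := by
    intro i j; rw [hX, hX, MvPolynomial.monomial_mul, one_mul]
  -- the three generating sets as images of exponent sets under `monomial · 1`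
  have hS : ∀ (u v w : Fin 4 →₀ ℕ),
      ({MvPolynomial.monomial u (1 : ℤ), MvPolynomial.monomial v 1, MvPolynomial.monomial w 1} :
        Set (MvPolynomial (Fin 4) ℤ)) = (fun s => MvPolynomial.monomial s (1 : ℤ)) '' {u, v, w} := by
    intro u v w; simp only [Set.image_insert_eq, Set.image_singleton]
  -- domination of a sum of two distinct coordinate vectors
  have hadd : ∀ (m : Fin 4 →₀ ℕ) (i j : Fin 4), i ≠ j → e i ≤ m → e j ≤ m → e i + e j ≤ m := by
    intro m i j hij hi hj
    rw [Finsupp.le_def] at hi hj ⊢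
    intro k
    have hik := hi k
    have hjk := hj k
    simp only [e, Finsupp.coe_add, Pi.add_apply, Finsupp.single_apply] at hik hjk ⊢
    by_cases h1 : i = k
    · by_cases h2 : j = k
      · exact absurd (h1.trans h2.symm) hij
      · rw [if_pos h1, if_neg h2, add_zero]; rw [if_pos h1] at hik; exact hik
    · by_cases h2 : j = k
      · rw [if_neg h1, if_pos h2, zero_add]; rw [if_pos h2] at hjk; exact hjk
      · rw [if_neg h1, if_neg h2, add_zero]; exact Nat.zero_le _
  show Ideal.span {MvPolynomial.X 0, MvPolynomial.X 0 * MvPolynomial.X 1, MvPolynomial.X 2 * MvPolynomial.X 3} ⊓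
      Ideal.span {MvPolynomial.X 2, MvPolynomial.X 0 * MvPolynomial.X 1, MvPolynomial.X 2 * MvPolynomial.X 3} =
    Ideal.span ({MvPolynomial.X 0 * MvPolynomial.X 2, MvPolynomial.X 0 * MvPolynomial.X 1,
      MvPolynomial.X 2 * MvPolynomial.X 3} : Set (MvPolynomial (Fin 4) ℤ))
  rw [hXX, hXX, hXX, hX, hX, hS, hS, hS]
  apply le_antisymm
  · intro x hx
    rw [Submodule.mem_inf, MvPolynomial.mem_ideal_span_monomial_image,
      MvPolynomial.mem_ideal_span_monomial_image] at hx
    rw [MvPolynomial.mem_ideal_span_monomial_image]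
    intro m hm
    obtain ⟨s, hs, hsm⟩ := hx.1 m hm
    obtain ⟨t, ht, htm⟩ := hx.2 m hm
    simp only [Set.mem_insert_iff, Set.mem_singleton_iff] at hs ht
    rcases hs with rfl | rfl | rfl
    · rcases ht with rfl | rfl | rfl
      · exact ⟨e 0 + e 2, by simp, hadd m 0 2 (by decide) hsm htm⟩
      · exact ⟨e 0 + e 1, by simp, htm⟩
      · exact ⟨e 2 + e 3, by simp, htm⟩
    · exact ⟨e 0 + e 1, by simp, hsm⟩
    · exact ⟨e 2 + e 3, by simp, hsm⟩
  · apply le_inf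
    · apply Ideal.span_le.2
      intro y hy
      simp only [Set.mem_image, Set.mem_insert_iff, Set.mem_singleton_iff] at hy
      obtain ⟨s, hs, rfl⟩ := hy
      rcases hs with rfl | rfl | rfl
      · have : MvPolynomial.monomial (e 0 + e 2) (1 : ℤ) = MvPolynomial.monomial (e 0) 1 * MvPolynomial.monomial (e 2) 1 := by
          rw [MvPolynomial.monomial_mul, one_mul]
        rw [this]
        exact Ideal.mul_mem_right _ _ (Ideal.subset_span ⟨e 0, by simp, rfl⟩)
      · exact Ideal.subset_span ⟨e 0 + e 1, by simp, rfl⟩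
      · exact Ideal.subset_span ⟨e 2 + e 3, by simp, rfl⟩
    · apply Ideal.span_le.2
      intro y hy
      simp only [Set.mem_image, Set.mem_insert_iff, Set.mem_singleton_iff] at hy
      obtain ⟨s, hs, rfl⟩ := hy
      rcases hs with rfl | rfl | rfl
      · have : MvPolynomial.monomial (e 0 + e 2) (1 : ℤ) = MvPolynomial.monomial (e 2) 1 * MvPolynomial.monomial (e 0) 1 := by
          rw [MvPolynomial.monomial_mul, one_mul, add_comm]
        rw [this]
        exact Ideal.mul_mem_right _ _ (Ideal.subset_span ⟨e 2, by simp, rfl⟩)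
      · exact Ideal.subset_span ⟨e 0 + e 1, by simp, rfl⟩
      · exact Ideal.subset_span ⟨e 2 + e 3, by simp, rfl⟩

/-- **KERNEL TOY of rev 3 (ii′), step P⁺1 — bi-kernel ideals from DISJOINT tensor factors meet in their product.**  In
`ℤ[x₁,y₁,x₂,y₂]` (`xᵢ` ↔ `αᵢ − 1`, `yᵢ` ↔ the inertia coordinate of the `i`-th local factor): `(x₁, y₁) ⊓ (x₂, y₂) = (x₁x₂, x₁y₂, y₁x₂, y₁y₂)`
`= (x₁, y₁)·(x₂, y₂)`.  The real statement is `Tor₁^{R_∞}(R_∞/𝔄₁R_∞, R_∞/𝔄₂R_∞) = 0` for `𝒪`-flat quotients of different factors of a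
completed tensor product; this is its polynomial shadow (monomial ideals: pairwise lcm's).  CONTRAST: the images in the Hecke ring do NOT
meet in their product (monogen5 §5 NO-GO). [folklore] -/
def BiKernelTransversality : Prop :=
  let x₁ : MvPolynomial (Fin 4) ℤ := MvPolynomial.X 0
  let y₁ : MvPolynomial (Fin 4) ℤ := MvPolynomial.X 1
  let x₂ : MvPolynomial (Fin 4) ℤ := MvPolynomial.X 2
  let y₂ : MvPolynomial (Fin 4) ℤ := MvPolynomial.X 3
  Ideal.span {x₁, y₁} ⊓ Ideal.span {x₂, y₂} = Ideal.span {x₁ * x₂, x₁ * y₂, y₁ * x₂, y₁ * y₂}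

/-- `BiKernelTransversality` HOLDS (kernel, rev 3): support-wise domination, as for `monomialTransversality`. [folklore] -/
theorem biKernelTransversality : BiKernelTransversality := by
  let e : Fin 4 → (Fin 4 →₀ ℕ) := fun i => Finsupp.single i 1
  have hX : ∀ i : Fin 4, (MvPolynomial.X i : MvPolynomial (Fin 4) ℤ) = MvPolynomial.monomial (e i) 1 := fun i => rfl
  have hXX : ∀ i j : Fin 4, (MvPolynomial.X i * MvPolynomial.X j : MvPolynomial (Fin 4) ℤ) =
      MvPolynomial.monomial (e i + e j) 1 := by
    intro i j; rw [hX, hX, MvPolynomial.monomial_mul, one_mul]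
  have hS2 : ∀ (u v : Fin 4 →₀ ℕ),
      ({MvPolynomial.monomial u (1 : ℤ), MvPolynomial.monomial v 1} : Set (MvPolynomial (Fin 4) ℤ)) =
        (fun s => MvPolynomial.monomial s (1 : ℤ)) '' {u, v} := by
    intro u v; simp only [Set.image_insert_eq, Set.image_singleton]
  have hS4 : ∀ (u v w z : Fin 4 →₀ ℕ),
      ({MvPolynomial.monomial u (1 : ℤ), MvPolynomial.monomial v 1, MvPolynomial.monomial w 1, MvPolynomial.monomial z 1} :
        Set (MvPolynomial (Fin 4) ℤ)) = (fun s => MvPolynomial.monomial s (1 : ℤ)) '' {u, v, w, z} := by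
    intro u v w z; simp only [Set.image_insert_eq, Set.image_singleton]
  have hadd : ∀ (m : Fin 4 →₀ ℕ) (i j : Fin 4), i ≠ j → e i ≤ m → e j ≤ m → e i + e j ≤ m := by
    intro m i j hij hi hj
    rw [Finsupp.le_def] at hi hj ⊢
    intro k
    have hik := hi k
    have hjk := hj k
    simp only [e, Finsupp.coe_add, Pi.add_apply, Finsupp.single_apply] at hik hjk ⊢
    by_cases h1 : i = k
    · by_cases h2 : j = k
      · exact absurd (h1.trans h2.symm) hij
      · rw [if_pos h1, if_neg h2, add_zero]; rw [if_pos h1] at hik; exact hik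
    · by_cases h2 : j = k
      · rw [if_neg h1, if_pos h2, zero_add]; rw [if_pos h2] at hjk; exact hjk
      · rw [if_neg h1, if_neg h2, add_zero]; exact Nat.zero_le _
  show Ideal.span {MvPolynomial.X 0, MvPolynomial.X 1} ⊓ Ideal.span {MvPolynomial.X 2, MvPolynomial.X 3} =
    Ideal.span ({MvPolynomial.X 0 * MvPolynomial.X 2, MvPolynomial.X 0 * MvPolynomial.X 3,
      MvPolynomial.X 1 * MvPolynomial.X 2, MvPolynomial.X 1 * MvPolynomial.X 3} : Set (MvPolynomial (Fin 4) ℤ))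
  rw [hXX, hXX, hXX, hXX, hX, hX, hX, hX, hS2, hS2, hS4]
  apply le_antisymm
  · intro x hx
    rw [Submodule.mem_inf, MvPolynomial.mem_ideal_span_monomial_image,
      MvPolynomial.mem_ideal_span_monomial_image] at hx
    rw [MvPolynomial.mem_ideal_span_monomial_image]
    intro m hm
    obtain ⟨s, hs, hsm⟩ := hx.1 m hm
    obtain ⟨t, ht, htm⟩ := hx.2 m hm
    simp only [Set.mem_insert_iff, Set.mem_singleton_iff] at hs ht
    rcases hs with rfl | rfl
    · rcases ht with rfl | rfl
      · exact ⟨e 0 + e 2, by simp, hadd m 0 2 (by decide) hsm htm⟩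
      · exact ⟨e 0 + e 3, by simp, hadd m 0 3 (by decide) hsm htm⟩
    · rcases ht with rfl | rfl
      · exact ⟨e 1 + e 2, by simp, hadd m 1 2 (by decide) hsm htm⟩
      · exact ⟨e 1 + e 3, by simp, hadd m 1 3 (by decide) hsm htm⟩
  · apply Ideal.span_le.2
    intro y hy
    simp only [Set.mem_image, Set.mem_insert_iff, Set.mem_singleton_iff] at hy
    obtain ⟨s, hs, rfl⟩ := hy
    -- each generator `monomial (e i + e j) 1 = monomial (e i) 1 * monomial (e j) 1` lies in both ideals
    have key : ∀ (i j : Fin 4), (i = 0 ∨ i = 1) → (j = 2 ∨ j = 3) →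
        MvPolynomial.monomial (e i + e j) (1 : ℤ) ∈
          Ideal.span ((fun s => MvPolynomial.monomial s (1 : ℤ)) '' {e 0, e 1}) ⊓
            Ideal.span ((fun s => MvPolynomial.monomial s (1 : ℤ)) '' {e 2, e 3}) := by
      intro i j hi hj
      have hmul : MvPolynomial.monomial (e i + e j) (1 : ℤ) =
          MvPolynomial.monomial (e i) 1 * MvPolynomial.monomial (e j) 1 := by
        rw [MvPolynomial.monomial_mul, one_mul]
      refine Submodule.mem_inf.2 ⟨?_, ?_⟩
      · rw [hmul]
        refine Ideal.mul_mem_right _ _ (Ideal.subset_span ⟨e i, ?_, rfl⟩)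
        rcases hi with rfl | rfl <;> simp
      · rw [hmul]
        refine Ideal.mul_mem_left _ _ (Ideal.subset_span ⟨e j, ?_, rfl⟩)
        rcases hj with rfl | rfl <;> simp
    rcases hs with rfl | rfl | rfl | rfl
    · exact key 0 2 (Or.inl rfl) (Or.inl rfl)
    · exact key 0 3 (Or.inl rfl) (Or.inr rfl)
    · exact key 1 2 (Or.inr rfl) (Or.inl rfl)
    · exact key 1 3 (Or.inr rfl) (Or.inr rfl)

/-- **KERNEL TOY of rev 3 (ii′), step P⁺6 — membership descends (intersections and annihilators need not).**  If two ideals of `A`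
meet in their product and `a` lies in both, then under ANY ring map `π : A →+* T` the image `π a` lies in the PRODUCT of the image
ideals — although `(I₁.map π) ⊓ (I₂.map π)` may be strictly larger than `(I₁.map π) * (I₂.map π)` (it is, for `R_∞ ↠ 𝕋_𝔪` and the two
bi-kernel ideals, by monogen5 §5: length `δ₁₂ ≥ 1`).  Applied with `A = R_∞`, `a = t_{η_∞}`, `T = 𝕋_𝔪`. [folklore] -/
theorem membership_descends {A T : Type*} [CommRing A] [CommRing T] (π : A →+* T) (I₁ I₂ : Ideal A)
    (h : I₁ ⊓ I₂ = I₁ * I₂) {a : A} (h₁ : a ∈ I₁) (h₂ : a ∈ I₂) :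
    π a ∈ Ideal.map π I₁ * Ideal.map π I₂ := by
  have ha : a ∈ I₁ * I₂ := by rw [← h]; exact Submodule.mem_inf.2 ⟨h₁, h₂⟩
  rw [← Ideal.map_mul]
  exact Ideal.mem_map_of_mem π ha

/-- FIRST LEMMA OF S4 (pure finite group theory; TYPED TOY, UNPROVED here — the prover of
`stub_taylorWiles_of_classX11a` proves it): for a prime `p ≥ 5` and a subgroup `G ≤ GL₂(𝔽_p)` with NO
`G`-stable line which contains the half split Cartan `{diag(u,1) : u ∈ 𝔽_pˣ}`, the subgroup `G ∩ SL₂(𝔽_p)` is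
non-abelian.  Proof on paper (rev-2 module docstring): an abelian `H = G ∩ SL₂` has `p ∤ |H|` (else the common
axis of its unipotents is `G`-stable), is not inside `{±1}` (else `G` is abelian and fixes the axes of `diag(u,1)`),
so lies in a unique Cartan `C` with `G ⊆ N(C)`; Serre 1972 §2.2 Prop. 14 (`p ≥ 5`) puts the half-Cartan in `C`,
so `C` is the diagonal torus, a `τ ∈ G ∖ C` swaps the axes, `C ⊆ G = N(C)`, and `diag(u,u⁻¹)`, `antidiag(1,−1)`
(`u² ≠ 1`) do not commute in `H`.  It FAILS for `p = 3` (`u = −1`: `N(C_ns)(𝔽₃)` qualifies).  DESK CHECK (exhaustive,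
seat folder `tmp/halfcartan_check.py`, 0 kit): the subgroups of `GL₂(𝔽_p)` containing `{diag(u,1)}` number 9 ∕ 12 ∕ 14 for
`p = 3 ∕ 5 ∕ 7`; the irreducible ones are, as `(|G|, |G ∩ SL₂|)`: `p = 5`: `(32, 8) = N(C_s)`, `(96, 24)` = PGL-image `S₄`,
`(480, 120) = GL₂` — all with non-abelian `SL₂`-part; `p = 7`: `(72, 12) = N(C_s)`, `(2016, 336) = GL₂`; `p = 3`: `(8, 4)`
VIOLATES (abelian `SL₂`-part), so `5 ≤ p` is sharp.  In S4 it is applied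
to `G = im ρ̄_{E,p}`: `Mult(p)` supplies the half-Cartan (Serre §1.12 Prop. 13, Tate curve) unless `G ∋` an
element of order `p` (then `G = GL₂` by `Literature.GroupTheory.DicksonGL2` + `Irr`), `Irr` supplies the
no-stable-line hypothesis, and `det ρ̄ = ε̄` identifies `ρ̄(G_{ℚ(ζ_p)})` with `G ∩ SL₂`. -/
def HalfCartanForcesNonabelian : Prop :=
  ∀ (p : ℕ) [Fact p.Prime], 5 ≤ p →
    ∀ G : Subgroup (GL (Fin 2) (ZMod p)),
      (∀ v : Fin 2 → ZMod p, v ≠ 0 →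
          ∃ g ∈ G, ∀ c : ZMod p, (g : Matrix (Fin 2) (Fin 2) (ZMod p)).mulVec v ≠ c • v) →
      (∀ u : (ZMod p)ˣ, ∃ g ∈ G, (g : Matrix (Fin 2) (Fin 2) (ZMod p)) = Matrix.diagonal ![(u : ZMod p), 1]) →
      ∃ g ∈ G, ∃ h ∈ G,
        Matrix.det (g : Matrix (Fin 2) (Fin 2) (ZMod p)) = 1 ∧ Matrix.det (h : Matrix (Fin 2) (Fin 2) (ZMod p)) = 1 ∧
          g * h ≠ h * g

/-! ## §2 The five registered statements -/

/-- **S1 — the thirteen Literature facts the record's turnkey consumes** (= line «oldprod5» S1 verbatim): Stein–Wuthrich 6.1 ×2,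
Kato 12.4, modularity, Kato §17.13 V′/VI′/XI′, Mazur 1978 Cor. 4.1, GZK, Coleman–Edixhoven 1998 Thm. 2.1, Greenberg–Vatsal 2000 §3,
Ribet 1984 Thm. 4.1 (Ihara), Darmon–Diamond–Taylor Thm. 3.15 at `p ≥ 5`.  Named facts, each typed in Literature; unproved there.
[cite: Kato2004Asterisque, Thm. 12.4 and §17.13] [cite: SteinWuthrich2013, Thm. 6.1] [cite: DarmonDiamondTaylor1995, Thm. 3.15] -/
def PrintFacts : Prop :=
  Literature.NumberTheory.EllipticCurves.SteinWuthrich2013.thm61_splitMultiplicative ∧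
    Literature.NumberTheory.EllipticCurves.SteinWuthrich2013.thm61_nonsplitMultiplicative ∧
    Literature.NumberTheory.EllipticCurves.Kato2004.thm12_4 ∧
    Literature.NumberTheory.EllipticCurves.ModularForms.exists_isNewformOf ∧
    Literature.NumberTheory.EllipticCurves.Kato2004.exists_multDivisibilityInputs_nonsplit_contra ∧
    Literature.NumberTheory.EllipticCurves.Kato2004.exists_multDivisibilityInputs_split_contra ∧
    Literature.NumberTheory.EllipticCurves.Kato2004.exists_multDivisibilityInputs_fine_contra ∧
    Literature.NumberTheory.EllipticCurves.ModularForms.mazur_not_dvd_maninConstant_of_odd ∧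
    rank_eq_analyticRank_of_analyticRank_le_one ∧
    colemanEdixhoven1998_heckePolynomial_simpleRoots ∧ greenbergVatsal2000_plusSymbol_congruence ∧
    ribet1984_iharaLemma ∧ ribet1990_levelLowering_gamma0_newform_general_of_five_le

/-- **S2 — THE ENGINE `ValueDepthTW` (research; the load-bearing stub).**  For minimal `E/ℚ` in class X11a with `ρ̄_{E,p}` not
surjective, `p ≥ 5`, the Taylor–Wiles hypothesis, and EVERY split multiplicative prime `ℓ ≠ p` GENERIC (`p ∤ ℓ² − 1`):
`ord_p (L(E,1)/Ω_E) ≥ ord_p ∏_ℓ c_ℓ`.  (No `Ш`, no depth hypothesis: BSD-true since `p ∤ #E(ℚ)_tors`; on X11a `ord_p ∏c = Σ_{ℓ split} v_p v_ℓ(Δ)`.)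
MECHANISM — REV 3 (ii′), THE PATCHED WINDING ELEMENT (module docstring «REV 3»; memo `MECHANISM-patched-winding-element-g36.md`
P⁺1–P⁺7; SKETCH): patch `(M_n, η_n, M_n ↠ M_n^{ℓᵢ-old})` over Taylor–Wiles levels (hypothesis `TaylorWiles` only; `p ∥ N` semistable-ordinary
condition at `p`, `D_p`-distinguished); (W) holds at every level (`(η′,η′) = (U_ℓ − 1)(0,−η′)` + dual Ihara), so `η_∞ ∈ ⋂ᵢ 𝔄ᵢM_∞`,
`𝔄ᵢ = (αᵢ − 1) + ker(R^□_{ℓᵢ} → R^{□,ur}_{ℓᵢ})` (`M_∞ ≅ R_∞`: multiplicity one at `N`, `R_∞` reduced, components inhabited; patched old-kernel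
= local ideal); the `𝔄ᵢ` live in different tensor factors with `𝒪`-flat quotients ⇒ `⋂ᵢ 𝔄ᵢM_∞ = (∏ᵢ 𝔄ᵢ)M_∞` (Tor-independence,
`biKernelTransversality`); membership descends (`membership_descends`): `t_η ∈ ∏ᵢ 𝔞ᵢ ⊂ 𝕋_𝔪`; evaluate at `x_E`: `𝔄ᵢ(x_E) = (ord_{ℓᵢ} q_E) =
p^{nᵢ}ℤ_p` (Tate ∕ Kummer; flat = crystalline component at `ℓᵢ = p`), `t_η(f_E) ∼ L(E,1)/Ω_E` ⇒ the displayed inequality.  It REPLACES the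
rev 1–2 mechanism kept below for the record — MECHANISM rev 1–2 (module docstring (i)–(iii); step (ii) WITHDRAWN: `Ann`/`∩` computed in `R_∞` do
not descend to `R = R_∞/𝔰`, monogen5 §5 NO-GO `ℓ((𝔞₁∩𝔞₂)/𝔞₁𝔞₂) = δ₁₂ ≥ 1`): `R = 𝕋_𝔪 = R_∞/(y)` by Wiles–Taylor–Wiles–Diamond patching at `p ∥ N` (type (Se)/(str),
`D_p`-distinguished as `p ≥ 5`) under `TaylorWiles` only; local factors `𝒪⟦a_ℓ,b_ℓ,…⟧/(a_ℓb_ℓ)` at generic carriers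
(BKM §3: `R_ℓ^St ≅ 𝒪⟦X₁,X₂,X₃⟧`, `R_ℓ^□` c.i. reduced) and at `ℓ = p` (type (Se): flat ∪ Steinberg); `R̄ = R/(b_S) = 𝕋^{S-new}_𝔪` c.i.
by patching (`ρ̄(Frob_ℓ) ≠ ±1`); transversality `Ann_{R_∞}(b_S) = (∏ a_ℓ)` + c.i. change of `η` ⟹ `η_f(R)/η_f(R̄) = p^{Σ n_ℓ}`,
`n_ℓ = ord_p θ_f(a_ℓ) = ord_p c_ℓ`; Gorenstein ⟹ `t_f ∈ (b_S) + p^{Σn_ℓ}R`; multiplicity one for the `W_S`-anti-invariant lattice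
`M^{−S}` ⟹ `φ_f ∈ Σ_ℓ (α_ℓ^♮ − β_ℓ^♮)H₁(X₀(N/ℓ)) + p^{Σn}M` (single-prime Ihara); `α_{ℓ*}e = β_{ℓ*}e` ⟹ `⟨e, φ_f⟩ ≡ 0 (mod p^{Σn})`;
ARS + Manin + GV ⟹ `Ω^{can} ∼ Ω_E`.  WHY IT MIGHT FAIL (rev 3): (a′) patching MARKED ELEMENTS `η_n` and the old-quotient maps is
routine in the ultrapatching formalism but unwritten for the winding element (units `u_n`, `Δ_Q`-compatibility of the `ℓᵢ`-degeneracies to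
check); (b′) the kernel comparison `K_{i,∞} = 𝔫ᵢM_∞` needs `M_∞ ≅ R_∞` — multiplicity one at level `N` with `p ∥ N` (Wiles 2.1 ✓),
reducedness of the completed tensor product, inhabitation of every component (Diamond–Taylor 1994 ∕ Ribet 1990 at `p`); (c′) the `ℓ = p`
factor: Kisin's semistable weight-2 ring = flat ∪ Steinberg node (Snowden §4), dual Ihara at `ℓ = p`, `E[p^m]` finite flat for `p^m ∣ v_p(q_E)`;
(d′) = old (c): `p = 5` constants; [rev 4, REF g31 §ZK (2)] (f) P⁺5's integral identification `(H₁(X₀(N/ℓᵢ))⊕²)_𝔪 ≅ H₁(X₀(N/ℓᵢ))_{𝔪′}` uses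
`αᵢ − βᵢ ≡ 1 − ℓᵢ` INVERTIBLE mod `𝔪` — supplied here by the binder `¬ p ∣ ℓ² − 1` (at a prime `ℓ ≡ 1` the two degeneracy images are not separated and (ii′) is
silent: that is S3's locus); (g) P⁺7's `λ_E(t_η) ∼ L(E,1)/Ω_E` uses `M = 𝕋γ` AND «no `p`-isogeny» (`Irr W p` from `ClassX11a`: optimal-versus-`E` periods differ by a
`p`-unit, Mazur's Manin constant at `p ∥ N` odd).  STATUS after KIT-T‴ (module docstring «REV 4»): falsifier (1) run once and PASSED (`ob₃(η) = 0`, triply-new value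
`3 = 1+1+1`), falsifier (3) bound 17 ∕ 17 (equality 15, `+1` twice, none below) + ramification predictions 2 ∕ 2; (ii′) remains a SKETCH modulo (a′)(b′)(c′)(d′)(f)(g).  Rev 1–2 list, kept: (a) the `p ∥ N`, small-image, `U_p`-included patching with product local
structure is print-ADJACENT (Wiles–Diamond give `R_Σ = 𝕋_Σ`; the c.i. of the `S`-new quotient with `p ∈ S` and the normal-crossing
shape of the type-(Se) ring at `p` are the steps to write); (b) freeness of the `W_S`-sign lattice over the anemic ring at `𝔪` with
`p ∥ N` needs Wiles Thm. 2.1 (`D_p`-distinguished ✓) plus sign bookkeeping; (c) at `p = 5` the patching datum needs an auxiliary-prime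
supply with `ρ̄(G_{ℚ(ζ_5)}) = 2·A₄` — fine for TW primes (`h⁰(G_{ℚ(ζ_p)}, ad⁰) = 0` ✓) but every constant must be re-checked at the
smallest prime.  `p`-UNIFORM as typed (at `p = 7` the only U5 image is the full `7Ns` by Lemma S4's proof; generic = `7 ∤ ℓ² − 1`).
FALSIFIER BOX (BSD-independent; rev 2 = V#152 P3, values from the in-tree records `PrintX11aHardLocusRecordsFive3/7`,
`PrintX11aMuCosetRecords*`, `PrintX11aUnitValueRecords*`): FIRED on all 44 tabulated U5 pairs at `p = 5` — S2's locus holds 42 of them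
(every split `ℓ ≠ 5` generic; `59040b1/c1`, `84960a1/w1`, `118080de1/df1`, `169920de1` have their `41`/`59 ≡ ±1` prime NON-split, checked
from `−c₆ mod ℓ`), and at all 42 `v₅(L(E,1)/Ω_E) = v₅(∏c)`: depth 2 with EQUALITY at `346560lh1` (`∏c = 100`, `c₅ = 10`, `L/Ω = 100`,
records l. 72), depth 1 (equality) at the 27 rows `115320u1 152280q1 154880bb1 154880bg1 184960ck1 184960l1 224720j1 230640bz1 25920q1
259920ec1 259920hc1 346560fq1 346680j1 389205n1 51840l1 51840m1 56180e1 59040b1 59040c1 6480d1 64980bg1 64980g1 74060f1 74060i1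
84960a1 86640dt1 92480eh1` (`L/Ω ∈ {5,10,15,20,30,40,120}` against `∏c` of the same `5`-order), depth 0 at the 14 unit rows.  NEXT
CHEAPEST FALSIFIER: any X11a pair (tabulated or new, any `p ≥ 5`) with all split `ℓ ≠ p` generic and `v_p(L(E,1)/Ω_E) < v_p(∏c)` kills S2
outright; the first informative new datum is a second depth-≥ 2 generic pair (LMFDB `N < 10⁶`, `c_p ∈ {10, 15, 25}` or two carriers).
[cite: Wiles1995, Thm. 2.1, Thm. 3.3] [cite: TaylorWiles1995, Thm. 1] [cite: Diamond1996, Thm. 1.1] [cite: Diamond1997, Thm. 2.4]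
[cite: Kisin2009, (3.4.12)] [cite: BockleKhareManning2021, §1 (arXiv:1910.08507 p. 3), §3 (p. 13)] [cite: AgasheRibetStein2012, Thm. 2.7]
[cite: Mazur1978, Cor. 4.1] [cite: GreenbergVatsal2000, Rem. 3.4] [cite: Ribet1984, Thm. 4.1] -/
def ValueDepthTW : Prop :=
  ∀ (W : WeierstrassCurve ℚ) [W.IsElliptic] [W.IsGloballyMinimal] (p : ℕ) [Fact p.Prime],
    ClassX11a W p → ¬ Surj W p → 5 ≤ p → TaylorWiles W p →
    (∀ (ℓ : ℕ) [Fact ℓ.Prime], W.HasSplitMultiplicativeReductionAtPrime ℓ → ℓ ≠ p → ¬ p ∣ ℓ ^ 2 - 1) →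
    ∀ t : ℚ, W.entireLFunction 1 / (W.realPeriodRat : ℂ) = (t : ℂ) →
      (padicValNat p W.tamagawaProduct : ℤ) ≤ padicValRat p t

/-- **S3 — RESIDUAL `ValueDepthVexing` (a carrier `ℓ ≠ p` with `p ∣ ℓ² − 1`; research, named tools).**  Same conclusion on the C_cc
locus (`ord_p ∏c ≥ 2`, `Ш[p] = 0`) when some split multiplicative `ℓ ≠ p` has `ℓ ≡ ±1 (mod p)`.  At a TRIVIAL carrier (`ℓ ≡ 1`,
`ρ̄(Frob_ℓ) = 1`) `R_ℓ^St` is Cohen–Macaulay but not Gorenstein and `𝕋^{ℓ-new}_𝔪` is not a complete intersection — the WILES DEFECT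
of Böckle–Khare–Manning, computed exactly by Manning's patched-module structure and BKM 2024's local–global formula; at `ℓ ≡ −1` two
Steinberg components (`a_ℓ = ±1`) meet.  The engine's steps (ii)–(iii) must be re-run with these local rings (the defect enters
`η(R)/η(R̄)` as an explicit correction).  Census (rev 2, in-tree records): `118080ds1` at `p = 5` (split carriers `5` and `41 ≡ 1 mod 5`,
`c₅ = c₄₁ = 5`, `∏c = 100`, `L(E,1)/Ω_E = 100`, `PrintX11aHardLocusRecordsFive3` l. 161) lives here and shows EQUALITY `v₅ = 2 = 2`; it is
the only tabulated row on this locus (`52345c1` has the vexing split prime `29 ≡ −1` but depth `v₅∏c = 1`, outside C_cc).  WHY IT MIGHT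
FAIL: the defect correction may eat exactly the extra `p` the sum needs (then only `max` survives at trivial places). [cite: BockleKhareManning2021, Thm. 1.2 (arXiv:1910.08507 p. 4)]
[cite: BockleKhareManning2024, Thm. 1.1] [cite: Shotton2016, Thm. 1.1] -/
def ValueDepthVexing : Prop :=
  ∀ (W : WeierstrassCurve ℚ) [W.IsElliptic] [W.IsGloballyMinimal] (p : ℕ) [Fact p.Prime],
    ClassX11a W p → ¬ Surj W p → 5 ≤ p → TaylorWiles W p →
    2 ≤ padicValNat p W.tamagawaProduct → (∀ x : W.sha, (p : ℤ) • x = 0 → x = 0) →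
    (∃ (ℓ : ℕ) (_ : Fact ℓ.Prime), W.HasSplitMultiplicativeReductionAtPrime ℓ ∧ ℓ ≠ p ∧ p ∣ ℓ ^ 2 - 1) →
    ∀ t : ℚ, W.entireLFunction 1 / (W.realPeriodRat : ℂ) = (t : ℂ) →
      (padicValNat p W.tamagawaProduct : ℤ) ≤ padicValRat p t

/-- **S4 — LEMMA `TWOnU5` (elementary, size M; rev 2 replaces the rev-1 research residual `ValueDepthDihedral`).**  On class X11a
with `p ≥ 5` the Taylor–Wiles hypothesis HOLDS: `ρ̄|G_{ℚ(μ_p)}` is irreducible with non-abelian image.  PROOF (print-level, five steps).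
Let `G = im ρ̄ ≤ GL₂(𝔽_p)`, `H = G ∩ SL₂(𝔽_p) = ρ̄(G_{ℚ(ζ_p)})` (Weil pairing: `det ρ̄ = ε̄`).  (1) `Mult W p` (Tate curve at `p`): `ρ̄|I_p ⊆
(ε̄ ∗; 0 1)` with `ε̄|I_p` onto `𝔽_pˣ` (Serre 1972 §1.12 Prop. 13), so either `G ∋` an element of order `p` — then `G ⊇ SL₂` or `G` is Borel
(Prop. 15 = tree `Literature.GroupTheory.DicksonGL2`), i.e. `G = GL₂` by `Irr`, and `H = SL₂` is non-abelian irreducible — or `G ⊇ C'`, a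
HALF SPLIT CARTAN `{diag(a,1)}` (up to conjugacy).  (2) Suppose `H` abelian.  `p ∤ |H|` (else `H`'s unipotents share one axis, which `G ⊵ H`
then fixes: reducible ✗), so `H` is a commuting set of semisimple elements: `H ⊆ {±1}` or `H ⊆ C` for the unique Cartan `C` through any
non-scalar `h ∈ H` (Serre §2.1).  (3) `H ⊆ {±1}`: `G/H ≅ det G` cyclic with `H` central ⟹ `G` abelian ∋ `diag(a,1)`, `a ≠ 1` ⟹ `G ⊆`
the split Cartan through it ⟹ reducible ✗.  (4) `H ⊆ C`: `G` normalises `H` hence `C`, so `G ⊆ N(C) ⊇ C'`; Serre Prop. 14 (`p ≥ 5`):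
`C' ⊆ C`, `C` split; `Irr` ⟹ `G ⊄ C`, pick `τ ∈ G ∖ C` (it swaps the two lines): `C = C'·τC'τ⁻¹ ⊆ G`, so `G = N(C_s)` and
`H = N(C_s) ∩ SL₂ ∋ diag(a,a⁻¹), τ'` with `a² ≠ 1` (`p ≥ 5`) — non-abelian ✗.  (5) Hence `H` is non-abelian, of order prime to `p` or
`= SL₂`, and an `𝔽_p`-stable line for `H` would (Maschke) make `H` diagonalisable, abelian ✗: `H` is irreducible — this is `TaylorWiles W p`
as typed (`FixesMuP p σ ⟺ σ ∈ G_{ℚ(μ_p)}`).  COROLLARY (images on U5): `G = N(C_s)` full, or `p = 5` and `G = 5S4` (`PGL₂`-image `S₄ ∋`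
an element of order `p − 1 = 4`); at `p = 5`: `5S4 ↦ H = 2·A₄ ⊇ Q₈`, `5Ns ↦ H = Q₈`; the index-2 sublabels of `5Ns` (`|H| = 4`, abelian,
where TW WOULD fail), `5Nn`, `7Ns.2.1/7Ns.3.1`, `7Nn` do not occur with multiplicative reduction at `p` — consistent with the 44 tabulated
U5 pairs (31 × `5S4`, 13 × `5Ns`) and with Zywina's lists.  So the rev-1 dihedral residual (`K_C = ℚ(√p*)`; tools Thorne 2016 ∕
Skinner–Wiles 2001) is EMPTY and needs no research.  LEAN ROUTE: Tate-curve inertia (`Mult` ⟹ the `(ε̄ ∗; 0 1)` shape on `geomTorsion`),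
`det ρ̄ = ε̄` (Weil pairing) to identify `FixesMuP` with `det = 1`, then finite group theory in `GL (Fin 2) (ZMod p)` (steps 2–5; the
transvection branch is the tree's `DicksonGL2.forall_exists_eq_of_transvections`).  WHY IT MIGHT FAIL: only in typing — the Literature
interface for `ρ̄|I_p` of a Tate curve and for the Weil-pairing determinant must be available BY NAME (else two named facts are added).
FIRST LEMMA (typed in §1, unproved): `HalfCartanForcesNonabelian` — the pure group theory in `GL (Fin 2) (ZMod p)`.
[cite: Serre1972PointsOrdreFini, §1.12 Prop. 13, §2.1, §2.2 Prop. 14, §2.4 Prop. 15, §2.7 Prop. 17 + Remarque (p = 5: PGL-image S₄)]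
[cite: SilvermanATAEC1994, V §3 Thm. 3.1 and Ex. 5.13] [cite: Zywina2015, Thm. 1.4] -/
def TWOnU5 : Prop :=
  ∀ (W : WeierstrassCurve ℚ) [W.IsElliptic] [W.IsGloballyMinimal] (p : ℕ) [Fact p.Prime],
    ClassX11a W p → 5 ≤ p → TaylorWiles W p

/-- **S5 — `ShaCore` = the record's C_Ш VERBATIM (shared with «gl1cartan5» rev 12; this line does not touch it).**  U5 at the pairs with
`Ш(E)[p] ≠ 0`. [cite: Miller2011LMS, Def. 1.1 (arXiv:1010.2431 p. 3)] [cite: Kato2004Asterisque, §17.13] -/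
def ShaCore : Prop :=
  ∀ (W : WeierstrassCurve ℚ) [W.IsElliptic] [W.IsGloballyMinimal] (p : ℕ) [Fact p.Prime],
    ClassX11a W p → ¬ Surj W p → 5 ≤ p → (∃ x : W.sha, (p : ℤ) • x = 0 ∧ x ≠ 0) → MissingUpperBoundAt W p

/-! ## §3 The five registered stubs (`sorry` lives ONLY here) -/

/-- Stub S1 (13 Literature facts; unproved in Literature, typed there). [cite: Kato2004Asterisque, Thm. 12.4] -/
theorem stub_printFacts : PrintFacts := by
  sorry

/-- Stub S2 — THE ENGINE (research). [cite: Wiles1995, Thm. 2.1] [cite: BockleKhareManning2021, §3] -/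
theorem stub_valueDepthTW : ValueDepthTW := by
  sorry

/-- Stub S3 — residual, vexing ∕ trivial carriers (research). [cite: BockleKhareManning2021, Thm. 1.2] -/
theorem stub_valueDepthVexing : ValueDepthVexing := by
  sorry

/-- Stub S4 — the elementary lemma «TW holds on U5» (size M; Serre 1972 Props. 13–15). [cite: Serre1972PointsOrdreFini, §2.2 Prop. 14] -/
theorem stub_taylorWiles_of_classX11a : TWOnU5 := by
  sorry

/-- Stub S5 — the record's C_Ш (open). [cite: Miller2011LMS, Def. 1.1] -/
theorem stub_shaCore : ShaCore := by
  sorry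

/-! ## §4 Composition (real proofs) -/

/-- **Value depth on the whole C_cc locus from S2–S4** (S4 supplies the TW hypothesis; fact-free case split all carriers generic ∕ a
vexing carrier). [cite: Miller2011LMS, Def. 1.1] -/
theorem valueDepth_all (hT5 : TWOnU5) (hTW : ValueDepthTW) (hVx : ValueDepthVexing) :
    ∀ (W : WeierstrassCurve ℚ) [W.IsElliptic] [W.IsGloballyMinimal] (p : ℕ) [Fact p.Prime],
      ClassX11a W p → ¬ Surj W p → 5 ≤ p → 2 ≤ padicValNat p W.tamagawaProduct →
      (∀ x : W.sha, (p : ℤ) • x = 0 → x = 0) →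
      ∀ t : ℚ, W.entireLFunction 1 / (W.realPeriodRat : ℂ) = (t : ℂ) →
        (padicValNat p W.tamagawaProduct : ℤ) ≤ padicValRat p t := by
  intro W _ _ p _ hX hns hp5 h2 hSha t ht
  have hT : TaylorWiles W p := hT5 W p hX hp5
  by_cases hgen : ∀ (ℓ : ℕ) [Fact ℓ.Prime], W.HasSplitMultiplicativeReductionAtPrime ℓ → ℓ ≠ p → ¬ p ∣ ℓ ^ 2 - 1
  · exact hTW W p hX hns hp5 hT hgen t ht
  · have hex : ∃ (ℓ : ℕ) (_ : Fact ℓ.Prime), W.HasSplitMultiplicativeReductionAtPrime ℓ ∧ ℓ ≠ p ∧ p ∣ ℓ ^ 2 - 1 := by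
      by_contra hne
      apply hgen
      intro ℓ hℓ hsp hℓp hdvd
      exact hne ⟨ℓ, hℓ, hsp, hℓp, hdvd⟩
    exact hVx W p hX hns hp5 hT h2 hSha hex t ht

/-- **U5 from the five statements (real proof):** S4 + S2 + S3 give the socket binder `hV` of `GL1Cartan.tamagawaDepthCore_of_valueDepth`
(p695354), whose output is C_cc; with S5 = C_Ш and the thirteen facts, `GL1Cartan.upperNonSurjFive_of_elevenFacts_of_twoCores` (p691730)
concludes.  CONDITIONAL on every displayed hypothesis. [cite: Kato2004Asterisque, §17.13 (pp. 279–280)] [cite: Miller2011LMS, Def. 1.1] -/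
theorem UpperNonSurjFive_of_hyps (hP : PrintFacts) (hTW : ValueDepthTW) (hVx : ValueDepthVexing)
    (hT5 : TWOnU5) (hC : ShaCore) : Theses.PrintX11a.UpperNonSurjFive := by
  obtain ⟨hJs, hJn, h12, hnf, hns', hsp', hfine', hMz, hGZK, hCE, hGV, hI, hLL⟩ := hP
  exact upperNonSurjFive_of_elevenFacts_of_twoCores hJs hJn h12 hnf hns' hsp' hfine' hMz hGZK hCE hGV hI hLL hC
    (tamagawaDepthCore_of_valueDepth hGZK hnf hMz (valueDepth_all hT5 hTW hVx))

/-- **Composition U5 — the crux BY NAME, stub-fed (real proof; `sorry` only inside the five stubs).** [cite: Miller2011LMS, Def. 1.1] -/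
theorem UpperNonSurjFive_of_twpatch : Theses.PrintX11a.UpperNonSurjFive :=
  UpperNonSurjFive_of_hyps stub_printFacts stub_valueDepthTW stub_valueDepthVexing stub_taylorWiles_of_classX11a stub_shaCore

end Summit.BirchSwinnertonDyer.BirchSwinnertonDyer.Cruxes.UpperNonSurjFive.TWPatch

end
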